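import Mathlib.Analysis.InnerProductSpace.Calculus
import Mathlib.Analysis.Normed.Module.Ball.Homeomorph
import Literature.Topology.FourManifolds.GluckTwist
import Literature.Topology.FourManifolds.GluckTwistProofs
import Literature.Topology.FourManifolds.GluingUniqueness
import Literature.Topology.FourManifolds.SmoothEmbeddingComp
import HarnessLib

/-!
# Locality of the Gluck twist in the tubular neighbourhood; pushing tube diffeomorphisms to `S⁴`

Second file of the decomposition of the named fact `Literature.Topology.FourManifolds.nonempty_diffeomorph_of_isGluckTwist`
(`GluckTwist.lean`; H. Gluck, *The embedding of two-spheres in the four-sphere*, Trans. AMS 104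
(1962), §8: the Gluck twist `Σ_K` is independent of the tubular neighbourhood). Everything here is
proved; nothing in `GluckTwist.lean` is modified.

Recall that `IsGluckTwist IX X K` presents `X` as an open gluing (`Literature.Topology.FourManifolds.IsOpenGluing`) of
`S⁴ ∖ K(S²)` and `S² × ℝ²` along `gluckRel ν` for a tubular neighbourhood `ν : S² × ℝ² ↪ S⁴`.
Two elementary devices are set up:

* **Locality.** `Literature.TwoKnot.TubularNbhd.squeeze ν r = ν ∘ fibreSqueeze r`, the restriction of `ν`
  to the open tube `S² × B_r` reparametrised radially over `S² × ℝ²` (Mathlib's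
  `OpenPartialHomeomorph.univBall`), is again a tubular neighbourhood, and a manifold glued along
  `gluckRel ν` is also glued along `gluckRel (ν.squeeze r)` (`Literature.Topology.FourManifolds.isOpenGluing_gluckRel_squeeze`:
  replace `jB` by `jB ∘ fibreSqueeze r`; the Gluck map commutes with radial maps). Consequently
  (`Literature.Topology.FourManifolds.nonempty_diffeomorph_of_tubularNbhd_eqOn`) **two Gluck twists formed with tubular
  neighbourhoods that agree on some tube `S² × B_r` are diffeomorphic** — the Gluck twist only
  depends on the germ of `ν` along the knot (Kosinski, *Differential Manifolds* (1993), III.3: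
  proper tubular neighbourhoods; VI.1: uniqueness of gluings).
* **Pushing forward.** For a diffeomorphism `Θ` of `S² × ℝ²` equal to the identity outside a tube
  `S² × B̄_R`, `Literature.TwoKnot.TubularNbhd.pushforwardDiffeo ν Θ` is the diffeomorphism `ψ` of `S⁴`
  given by `ν ∘ Θ ∘ ν⁻¹` on the range of `ν` and the identity elsewhere, so that `ψ ∘ ν = ν ∘ Θ`
  (extension by the identity of a compactly supported diffeomorphism of an open subset; Hirsch,
  *Differential Topology* (1976), Ch. 8 §1). Smoothness across the seam is the descent of
  smoothness along the open immersion `ν` (`Literature.Topology.FourManifolds.contMDiffAt_of_comp_isImmersionAt`).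

Precomposition of a smooth embedding with a globally defined *partial* diffeomorphism
(`Manifold.IsSmoothEmbedding.comp_openPartialHomeomorph`, a special case of Mathlib's
`proof_wanted IsSmoothEmbedding.comp`) lives upstream in `SmoothEmbeddingComp.lean`.

## References

* H. Gluck, *The embedding of two-spheres in the four-sphere*, Trans. Amer. Math. Soc. 104 (1962)
  308–333, §8 [GluckTAMS1962].
* A. Kosinski, *Differential Manifolds*, Academic Press (1993), Ch. III §3, Ch. VI §1
  [Kosinski1993].
* M. W. Hirsch, *Differential Topology*, GTM 33, Springer (1976), Ch. 8 §1.

## Design notes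

* Names from `OpenPartialHomeomorph` are written fully qualified: inside `namespace Literature` the
  command `open OpenPartialHomeomorph` resolves to the tree's namespace `Literature.OpenPartialHomeomorph`
  as soon as `ChartTransport.lean` is imported downstream.
* refactor: `TwoKnot.TubularNbhd.pushforward` / `pushforwardDiffeo` is the tubular-neighbourhood
  instance of the device `Literature.Topology.FourManifolds.chartTransport` / `Literature.Topology.FourManifolds.exists_diffeomorph_chartTransport`
  (`ChartTransport.lean`: the same `Function.extend`-by-the-identity construction and the same
  support convention `R ≤ ‖y‖ → Θ y = y`, there for a chart onto a vector space `E`). The two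
  differ only in the source of the open embedding (`S² × ℝ²` here, `E` there), so
  `ChartTransport` cannot be instantiated directly; the natural common generalisation is
  "extension by the identity, along an open smooth embedding `j : A → P`, of a diffeomorphism of
  `A` equal to the identity off a compact set", into which both should eventually be merged.
* No declaration in this file uses `sorry`.
-/

open scoped Manifold ContDiff Topology
open Function Set

noncomputable section

namespace Literature.Topology.FourManifolds

/-- Local notation: `𝔼 n` is the model Euclidean space `EuclideanSpace ℝ (Fin n)`. -/
local notation "𝔼 " n:arg => EuclideanSpace ℝ (Fin n)

/-- Local notation: `𝕊 n` is the unit sphere in `EuclideanSpace ℝ (Fin (n + 1))`. -/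
local notation "𝕊 " n:arg => (Metric.sphere (0 : EuclideanSpace ℝ (Fin (n + 1))) 1)

/-! ### The radial squeeze of the fibre `ℝ² → B_r` -/

section Squeeze

open Metric

variable {r : ℝ}

/-- Mathlib's diffeomorphism `OpenPartialHomeomorph.univBall 0 r : ℝ² → B_r` (`r > 0`) is the radial map
`w ↦ (r / √(1 + ‖w‖²)) w`. [folklore] -/
theorem univBall_zero_apply (hr : 0 < r) (w : 𝔼 2) :
    OpenPartialHomeomorph.univBall (0 : 𝔼 2) r w = (r * (√(1 + ‖w‖ ^ 2))⁻¹) • w := by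
  rw [OpenPartialHomeomorph.univBall, dif_pos hr, OpenPartialHomeomorph.trans'_apply, OpenPartialHomeomorph.unitBallBall_apply,
    OpenPartialHomeomorph.univUnitBall_apply]
  simp [smul_smul]

/-- The radial map `OpenPartialHomeomorph.univBall 0 r` multiplies each vector by a positive scalar. [folklore] -/
theorem exists_univBall_zero_apply_eq_smul (hr : 0 < r) (w : 𝔼 2) :
    ∃ t : ℝ, 0 < t ∧ OpenPartialHomeomorph.univBall (0 : 𝔼 2) r w = t • w :=
  ⟨r * (√(1 + ‖w‖ ^ 2))⁻¹, mul_pos hr (inv_pos.2 (Real.sqrt_pos.2 (by positivity))),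
    univBall_zero_apply hr w⟩

/-- The radial map preserves being non-zero. [folklore] -/
theorem univBall_zero_apply_ne_zero_iff (hr : 0 < r) (w : 𝔼 2) :
    OpenPartialHomeomorph.univBall (0 : 𝔼 2) r w ≠ 0 ↔ w ≠ 0 := by
  obtain ⟨t, ht, h⟩ := exists_univBall_zero_apply_eq_smul hr w
  rw [h, smul_ne_zero_iff]
  exact ⟨fun h => h.2, fun h => ⟨ht.ne', h⟩⟩

/-- The radial map does not change unit vectors: `unitVector (OpenPartialHomeomorph.univBall 0 r w) = unitVector w`.
[folklore] -/
theorem unitVector_univBall_zero_apply (hr : 0 < r) (w : 𝔼 2) (hw : w ≠ 0)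
    (hw' : OpenPartialHomeomorph.univBall (0 : 𝔼 2) r w ≠ 0 := (univBall_zero_apply_ne_zero_iff hr w).2 hw) :
    unitVector (OpenPartialHomeomorph.univBall (0 : 𝔼 2) r w) hw' = unitVector w hw := by
  obtain ⟨t, ht, h⟩ := exists_univBall_zero_apply_eq_smul hr w
  have hw'' : t • w ≠ 0 := smul_ne_zero ht.ne' hw
  have : unitVector (OpenPartialHomeomorph.univBall (0 : 𝔼 2) r w) hw' = unitVector (t • w) hw'' := by
    congr 1
  rw [this, unitVector_smul ht w hw]

/-- The **fibrewise radial squeeze** `S² × ℝ² ⇀ S² × B_r`, `(x, w) ↦ (x, r w / √(1 + ‖w‖²))`, as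
an open partial homeomorphism with source `univ` (the product of the identity of `S²` with
Mathlib's `OpenPartialHomeomorph.univBall 0 r`). Used to replace a tubular neighbourhood by
its restriction to the tube of radius `r`, reparametrised over the whole plane (Kosinski's
"`ε`-shrinking", *Differential Manifolds*, III.3). [folklore] -/
def fibreSqueeze (r : ℝ) : OpenPartialHomeomorph ((𝕊 2) × 𝔼 2) ((𝕊 2) × 𝔼 2) :=
  (OpenPartialHomeomorph.refl (𝕊 2)).prod (OpenPartialHomeomorph.univBall (0 : 𝔼 2) r)

/-- The squeeze acts as `OpenPartialHomeomorph.univBall 0 r` on the fibre. [folklore] -/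
@[simp]
theorem fibreSqueeze_apply (r : ℝ) (p : (𝕊 2) × 𝔼 2) :
    fibreSqueeze r p = (p.1, OpenPartialHomeomorph.univBall (0 : 𝔼 2) r p.2) := rfl

/-- The inverse squeeze acts as `(OpenPartialHomeomorph.univBall 0 r)⁻¹` on the fibre. [folklore] -/
@[simp]
theorem fibreSqueeze_symm_apply (r : ℝ) (p : (𝕊 2) × 𝔼 2) :
    (fibreSqueeze r).symm p = (p.1, (OpenPartialHomeomorph.univBall (0 : 𝔼 2) r).symm p.2) := rfl

/-- The squeeze is defined everywhere. [folklore] -/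
@[simp]
theorem fibreSqueeze_source (r : ℝ) : (fibreSqueeze r).source = univ := by
  simp [fibreSqueeze]

/-- The image of the squeeze is the open tube of radius `r`. [folklore] -/
theorem fibreSqueeze_target (hr : 0 < r) : (fibreSqueeze r).target = univ ×ˢ ball (0 : 𝔼 2) r := by
  simp [fibreSqueeze, OpenPartialHomeomorph.univBall_target _ hr]

/-- The squeeze fixes the zero section. [folklore] -/
@[simp]
theorem fibreSqueeze_apply_zero (r : ℝ) (x : 𝕊 2) : fibreSqueeze r (x, 0) = (x, 0) := by
  simp

/-- The squeeze is smooth. [folklore] -/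
theorem contMDiffOn_fibreSqueeze (r : ℝ) :
    ContMDiffOn ((𝓡 2).prod 𝓘(ℝ, 𝔼 2)) ((𝓡 2).prod 𝓘(ℝ, 𝔼 2)) ∞ (fibreSqueeze r)
      (fibreSqueeze r).source := by
  have h : ContMDiff ((𝓡 2).prod 𝓘(ℝ, 𝔼 2)) ((𝓡 2).prod 𝓘(ℝ, 𝔼 2)) ∞
      (fun p : (𝕊 2) × 𝔼 2 => (p.1, OpenPartialHomeomorph.univBall (0 : 𝔼 2) r p.2)) :=
    contMDiff_fst.prodMk
      ((OpenPartialHomeomorph.contDiff_univBall (n := ⊤)).contMDiff.comp contMDiff_snd)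
  exact h.contMDiffOn

/-- The inverse of the squeeze is smooth on the open tube. [folklore] -/
theorem contMDiffOn_fibreSqueeze_symm (hr : 0 < r) :
    ContMDiffOn ((𝓡 2).prod 𝓘(ℝ, 𝔼 2)) ((𝓡 2).prod 𝓘(ℝ, 𝔼 2)) ∞ (fibreSqueeze r).symm
      (fibreSqueeze r).target := by
  rw [fibreSqueeze_target hr]
  have h1 : ContMDiffOn ((𝓡 2).prod 𝓘(ℝ, 𝔼 2)) 𝓘(ℝ, 𝔼 2) ∞
      (fun p : (𝕊 2) × 𝔼 2 => (OpenPartialHomeomorph.univBall (0 : 𝔼 2) r).symm p.2) (univ ×ˢ ball (0 : 𝔼 2) r) :=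
    (OpenPartialHomeomorph.contDiffOn_univBall_symm (n := ⊤) (c := (0 : 𝔼 2)) (r := r)).contMDiffOn.comp
      contMDiff_snd.contMDiffOn fun p hp => hp.2
  exact (contMDiff_fst.contMDiffOn.prodMk h1).congr fun p _ => rfl

/-- The Gluck map commutes with the fibrewise squeeze (the rotation only depends on the unit
vector `w / ‖w‖`, which the radial squeeze does not change). [folklore] -/
theorem gluckMap_fibreSqueeze (hr : 0 < r) (p : (𝕊 2) × 𝔼 2) :
    gluckMap (fibreSqueeze r p) = fibreSqueeze r (gluckMap p) := by
  obtain ⟨x, w⟩ := p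
  by_cases hw : w = 0
  · subst hw
    simp
  · have hw' : OpenPartialHomeomorph.univBall (0 : 𝔼 2) r w ≠ 0 := (univBall_zero_apply_ne_zero_iff hr w).2 hw
    rw [fibreSqueeze_apply, gluckMap_apply_of_ne_zero x hw', gluckMap_apply_of_ne_zero x hw,
      fibreSqueeze_apply, unitVector_univBall_zero_apply hr w hw]

/-- The squeezed point is off the zero section iff the point is. [folklore] -/
theorem fibreSqueeze_snd_ne_zero_iff (hr : 0 < r) (p : (𝕊 2) × 𝔼 2) :
    (fibreSqueeze r p).2 ≠ 0 ↔ p.2 ≠ 0 :=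
  univBall_zero_apply_ne_zero_iff hr p.2

/-- The squeezed point lies in the tube of radius `r`. [folklore] -/
theorem fibreSqueeze_snd_mem_ball (hr : 0 < r) (p : (𝕊 2) × 𝔼 2) :
    (fibreSqueeze r p).2 ∈ ball (0 : 𝔼 2) r := by
  have h := (fibreSqueeze r).map_source (x := p) (by simp)
  rw [fibreSqueeze_target hr] at h
  exact h.2

end Squeeze

/-! ### Squeezed tubular neighbourhoods -/

namespace TwoKnot.TubularNbhd

open Metric

variable {K : 𝕊 2 → 𝕊 4}

/-- The **squeezed tubular neighbourhood** `ν.squeeze r = ν ∘ fibreSqueeze r`: the restriction of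
`ν` to the open tube `S² × B_r`, reparametrised radially over `S² × ℝ²`. It is again a tubular
neighbourhood of the same 2-sphere (a smooth embedding precomposed with a globally defined
partial diffeomorphism, `Manifold.IsSmoothEmbedding.comp_openPartialHomeomorph`) and only
depends on `ν` restricted to `S² × B_r` (Kosinski, *Differential Manifolds*, III.3, proper
tubular neighbourhoods obtained by shrinking). [folklore] -/
def squeeze (ν : TwoKnot.TubularNbhd K) (r : ℝ) (hr : 0 < r) : TwoKnot.TubularNbhd K where
  toFun := ν.toFun ∘ fibreSqueeze r
  isSmoothEmbedding := ν.isSmoothEmbedding.comp_openPartialHomeomorph (fibreSqueeze r)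
    (fibreSqueeze_source r) (contMDiffOn_fibreSqueeze r) (contMDiffOn_fibreSqueeze_symm hr)
  apply_zero x := by
    simp only [comp_apply, fibreSqueeze_apply_zero, ν.apply_zero]

/-- The squeezed tubular neighbourhood as a function. [folklore] -/
@[simp]
theorem squeeze_toFun (ν : TwoKnot.TubularNbhd K) (r : ℝ) (hr : 0 < r) :
    (ν.squeeze r hr).toFun = ν.toFun ∘ fibreSqueeze r := rfl

/-- Two tubular neighbourhoods which agree on the tube `S² × B_r` have the same squeeze (as maps).
[folklore] -/
theorem squeeze_toFun_eq_of_eqOn {ν ν' : TwoKnot.TubularNbhd K} {r : ℝ} (hr : 0 < r)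
    (heq : ∀ x : 𝕊 2, ∀ w ∈ ball (0 : 𝔼 2) r, ν.toFun (x, w) = ν'.toFun (x, w)) :
    (ν.squeeze r hr).toFun = (ν'.squeeze r hr).toFun := by
  funext p
  simp only [squeeze_toFun, comp_apply]
  have h := fibreSqueeze_snd_mem_ball hr p
  rw [fibreSqueeze_apply] at h ⊢
  exact heq _ _ h

end TwoKnot.TubularNbhd

/-! ### Locality: a Gluck twist only depends on the tubular neighbourhood near the knot -/

section Locality

open Metric

variable {EX HX HX' : Type*} [NormedAddCommGroup EX] [NormedSpace ℝ EX] [TopologicalSpace HX]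
  {IX : ModelWithCorners ℝ EX HX} [TopologicalSpace HX'] {IX' : ModelWithCorners ℝ EX HX'}
  {X X' : Type*} [TopologicalSpace X] [ChartedSpace HX X] [TopologicalSpace X']
  [ChartedSpace HX' X'] {K : TwoKnot} {r : ℝ}

/-- The Gluck relation of the squeezed tubular neighbourhood is the Gluck relation of `ν` after
squeezing the `S² × ℝ²` argument (`gluckMap` commutes with the squeeze). [folklore] -/
theorem gluckRel_squeeze_iff (ν : TwoKnot.TubularNbhd K) (hr : 0 < r) (a : K.complement)
    (b : (𝕊 2) × 𝔼 2) : gluckRel (ν.squeeze r hr) a b ↔ gluckRel ν a (fibreSqueeze r b) := by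
  simp only [gluckRel, TwoKnot.TubularNbhd.squeeze_toFun, comp_apply,
    gluckMap_fibreSqueeze hr, fibreSqueeze_snd_ne_zero_iff hr]

/-- **Squeezing the tubular neighbourhood does not change the Gluck twist.** If `X` is an open
gluing of `S⁴ ∖ K(S²)` and `S² × ℝ²` along `gluckRel ν` (embeddings `jA`, `jB`), then it is also
an open gluing along `gluckRel (ν.squeeze r)`, via `jA` and `jB ∘ fibreSqueeze r`: the points
`jB (x, w)` with `‖w‖ ≥ r` that are no longer in the range of the second embedding are of the form
`jA (ν (rot x, w))`. Hence the Gluck twist only depends on `ν` restricted to any tube `S² × B_r`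
(compare Kosinski, *Differential Manifolds*, III.3: proper tubular neighbourhoods). [folklore] -/
theorem isOpenGluing_gluckRel_squeeze {ν : TwoKnot.TubularNbhd K}
    (h : IsOpenGluing (𝓡 4) ((𝓡 2).prod 𝓘(ℝ, 𝔼 2)) IX (A := K.complement) (B := (𝕊 2) × 𝔼 2)
      (P := X) (gluckRel ν)) (hr : 0 < r) :
    IsOpenGluing (𝓡 4) ((𝓡 2).prod 𝓘(ℝ, 𝔼 2)) IX (A := K.complement) (B := (𝕊 2) × 𝔼 2)
      (P := X) (gluckRel (ν.squeeze r hr)) := by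
  obtain ⟨jA, jB, hA, hAo, hB, hBo, hU, hR⟩ := h
  have hBe : Topology.IsOpenEmbedding jB := ⟨hB.isEmbedding, hBo⟩
  refine ⟨jA, jB ∘ fibreSqueeze r, hA, hAo, hB.comp_openPartialHomeomorph (fibreSqueeze r)
    (fibreSqueeze_source r) (contMDiffOn_fibreSqueeze r) (contMDiffOn_fibreSqueeze_symm hr),
    ?_, ?_, fun a b => ?_⟩
  · rw [(fibreSqueeze r).range_comp_eq_image_target (fibreSqueeze_source r),
      fibreSqueeze_target hr]
    exact hBe.isOpenMap _ (isOpen_univ.prod isOpen_ball)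
  · refine eq_univ_of_forall fun p => ?_
    have hp : p ∈ range jA ∪ range jB := by rw [hU]; exact mem_univ p
    rcases hp with ⟨a, rfl⟩ | ⟨⟨x, w⟩, rfl⟩
    · exact Or.inl ⟨a, rfl⟩
    · by_cases hw : w ∈ ball (0 : 𝔼 2) r
      · refine Or.inr ⟨(x, (OpenPartialHomeomorph.univBall (0 : 𝔼 2) r).symm w), ?_⟩
        have hw' : w ∈ (OpenPartialHomeomorph.univBall (0 : 𝔼 2) r).target := by
          rwa [OpenPartialHomeomorph.univBall_target _ hr]
        simp only [comp_apply, fibreSqueeze_apply,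
          (OpenPartialHomeomorph.univBall (0 : 𝔼 2) r).right_inv hw']
      · have hw0 : w ≠ 0 := by
          rintro rfl
          exact hw (mem_ball_self hr)
        have hm : ν.toFun (gluckMap (x, w)) ∈ K.complement := by
          rw [gluckMap_apply_of_ne_zero x hw0]
          exact ν.apply_mem_compl_range _ hw0
        exact Or.inl ⟨⟨ν.toFun (gluckMap (x, w)), hm⟩,
          (hR _ _).2 (gluckRel_mk_gluckMap ν x hw0 hm)⟩
  · rw [comp_apply, hR, gluckRel_squeeze_iff]

/-- **Locality of the Gluck twist.** Let `ν`, `ν'` be tubular neighbourhoods of 2-knots `K`, `K'`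
with the same underlying map `S² → S⁴`, which agree on some tube `S² × B_r`. If `X` is an open
gluing along `gluckRel ν` and `X'` one along `gluckRel ν'`, then `X ≅ X'`: both are open gluings
along the common relation `gluckRel (ν.squeeze r) = gluckRel (ν'.squeeze r)`
(`isOpenGluing_gluckRel_squeeze`), and open gluings along one relation are unique
(`IsOpenGluing.nonempty_diffeomorph`, Kosinski VI.1). The knots are allowed to be given by
different (but pointwise equal) `TwoKnot` structures for flexibility downstream. [folklore] -/
theorem nonempty_diffeomorph_of_tubularNbhd_eqOn [IsManifold IX ∞ X] [IsManifold IX' ∞ X']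
    {K K' : TwoKnot} (hK : ⇑K = ⇑K') {ν : TwoKnot.TubularNbhd K} {ν' : TwoKnot.TubularNbhd K'}
    (hr : 0 < r) (heq : ∀ x : 𝕊 2, ∀ w ∈ ball (0 : 𝔼 2) r, ν.toFun (x, w) = ν'.toFun (x, w))
    (h : IsOpenGluing (𝓡 4) ((𝓡 2).prod 𝓘(ℝ, 𝔼 2)) IX (A := K.complement) (B := (𝕊 2) × 𝔼 2)
      (P := X) (gluckRel ν))
    (h' : IsOpenGluing (𝓡 4) ((𝓡 2).prod 𝓘(ℝ, 𝔼 2)) IX' (A := K'.complement) (B := (𝕊 2) × 𝔼 2)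
      (P := X') (gluckRel ν')) :
    Nonempty (X ≃ₘ⟮IX, IX'⟯ X') := by
  obtain rfl : K = K' := DFunLike.coe_injective hK
  have hrel : gluckRel (ν.squeeze r hr) = gluckRel (ν'.squeeze r hr) := by
    funext a b
    simp only [gluckRel, TwoKnot.TubularNbhd.squeeze_toFun_eq_of_eqOn hr heq]
  have h₁ := isOpenGluing_gluckRel_squeeze h hr
  rw [hrel] at h₁
  exact IsOpenGluing.nonempty_diffeomorph h₁ (isOpenGluing_gluckRel_squeeze h' hr)

end Locality

/-! ### Pushing a fibrewise compactly supported diffeomorphism of the tube into `S⁴` -/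

namespace TwoKnot.TubularNbhd

open Metric

variable {K : 𝕊 2 → 𝕊 4} (ν : TwoKnot.TubularNbhd K)

/-- The **push-forward along `ν`** of a self-map `Θ` of `S² × ℝ²`, extended by the identity
outside the range of `ν`: `ν p ↦ ν (Θ p)`, `y ↦ y` for `y ∉ ν(S² × ℝ²)`. When `Θ` is a
diffeomorphism equal to the identity outside a tube `S² × B̄_R`, this is a diffeomorphism of
`S⁴` (`pushforwardDiffeo`), the standard extension by the identity of a compactly supported
diffeomorphism of an open subset. Hirsch, *Differential Topology* (1976), Ch. 8 §1. [folklore] -/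
def pushforward (Θ : (𝕊 2) × 𝔼 2 → (𝕊 2) × 𝔼 2) : (𝕊 4) → 𝕊 4 :=
  Function.extend ν.toFun (ν.toFun ∘ Θ) id

/-- The push-forward on the range of `ν`. [folklore] -/
@[simp]
theorem pushforward_apply (Θ : (𝕊 2) × 𝔼 2 → (𝕊 2) × 𝔼 2) (p : (𝕊 2) × 𝔼 2) :
    ν.pushforward Θ (ν.toFun p) = ν.toFun (Θ p) :=
  ν.injective.extend_apply _ _ p

/-- The push-forward off the range of `ν` is the identity. [folklore] -/
theorem pushforward_of_not_mem (Θ : (𝕊 2) × 𝔼 2 → (𝕊 2) × 𝔼 2) {y : 𝕊 4}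
    (hy : y ∉ range ν.toFun) : ν.pushforward Θ y = y := by
  rw [pushforward, extend_apply' _ _ _ (by simpa only [mem_range] using hy)]
  rfl

/-- Push-forwards compose. [folklore] -/
theorem pushforward_pushforward (Θ Θ' : (𝕊 2) × 𝔼 2 → (𝕊 2) × 𝔼 2) (y : 𝕊 4) :
    ν.pushforward Θ (ν.pushforward Θ' y) = ν.pushforward (Θ ∘ Θ') y := by
  by_cases hy : y ∈ range ν.toFun
  · obtain ⟨p, rfl⟩ := hy
    simp
  · rw [ν.pushforward_of_not_mem Θ' hy, ν.pushforward_of_not_mem Θ hy,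
      ν.pushforward_of_not_mem _ hy]

/-- The push-forward of the identity is the identity. [folklore] -/
theorem pushforward_id (y : 𝕊 4) : ν.pushforward id y = y := by
  by_cases hy : y ∈ range ν.toFun
  · obtain ⟨p, rfl⟩ := hy
    simp
  · exact ν.pushforward_of_not_mem _ hy

/-- Outside the image of the tube `S² × B̄_R` the push-forward of a map supported in that tube
is the identity. [folklore] -/
theorem pushforward_eq_self_of_not_mem_image {Θ : (𝕊 2) × 𝔼 2 → (𝕊 2) × 𝔼 2} {R : ℝ}
    (hΘ : ∀ p : (𝕊 2) × 𝔼 2, R ≤ ‖p.2‖ → Θ p = p) {y : 𝕊 4}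
    (hy : y ∉ ν.toFun '' (univ ×ˢ closedBall (0 : 𝔼 2) R)) : ν.pushforward Θ y = y := by
  by_cases hy' : y ∈ range ν.toFun
  · obtain ⟨p, rfl⟩ := hy'
    rw [pushforward_apply, hΘ p]
    by_contra hp
    exact hy ⟨p, ⟨mem_univ _, mem_closedBall_zero_iff.2 (not_le.1 hp).le⟩, rfl⟩
  · exact ν.pushforward_of_not_mem Θ hy'

/-- **Smoothness of the push-forward.** If `Θ` is smooth and is the identity outside the tube
`S² × B̄_R`, then `ν.pushforward Θ` is smooth: at points `ν p` this is the descent of the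
smoothness of `ν ∘ Θ` along the open immersion `ν` (`contMDiffAt_of_comp_isImmersionAt`), and on
the open complement of the compact set `ν (S² × B̄_R)` the map is the identity. [folklore] -/
theorem contMDiff_pushforward {Θ : (𝕊 2) × 𝔼 2 → (𝕊 2) × 𝔼 2}
    (hΘs : ContMDiff ((𝓡 2).prod 𝓘(ℝ, 𝔼 2)) ((𝓡 2).prod 𝓘(ℝ, 𝔼 2)) ∞ Θ) {R : ℝ}
    (hΘ : ∀ p : (𝕊 2) × 𝔼 2, R ≤ ‖p.2‖ → Θ p = p) :
    ContMDiff (𝓡 4) (𝓡 4) ∞ (ν.pushforward Θ) := by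
  intro y
  by_cases hy : y ∈ range ν.toFun
  · obtain ⟨p, rfl⟩ := hy
    exact contMDiffAt_of_comp_isImmersionAt (ν.isSmoothEmbedding.isImmersion.isImmersionAt p)
      ν.isOpenMap ((ν.contMDiff.comp hΘs) p) (fun p' => ν.pushforward_apply Θ p')
  · have hC : IsClosed (ν.toFun '' (univ ×ˢ closedBall (0 : 𝔼 2) R)) :=
      ((isCompact_univ.prod (isCompact_closedBall _ _)).image ν.continuous).isClosed
    have hyC : y ∈ (ν.toFun '' (univ ×ˢ closedBall (0 : 𝔼 2) R))ᶜ := fun h =>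
      hy (image_subset_range _ _ h)
    refine contMDiffAt_id.congr_of_eventuallyEq ?_
    filter_upwards [hC.isOpen_compl.mem_nhds hyC] with z hz
    exact ν.pushforward_eq_self_of_not_mem_image hΘ hz

/-- **Extension by the identity of a fibrewise compactly supported diffeomorphism of the tube.**
For a diffeomorphism `Θ` of `S² × ℝ²` which is the identity outside `S² × B̄_R`, the
push-forward `ν p ↦ ν (Θ p)` (identity off the range of `ν`) is a diffeomorphism `ψ` of `S⁴`
with `ψ ∘ ν = ν ∘ Θ`. This elementary device replaces, for the explicit isotopies used in the
well-definedness of the Gluck twist, the isotopy extension theorem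
(Hirsch, *Differential Topology* (1976), Thm. 8.1.3). [folklore] -/
def pushforwardDiffeo (Θ : ((𝕊 2) × 𝔼 2) ≃ₘ⟮(𝓡 2).prod 𝓘(ℝ, 𝔼 2), (𝓡 2).prod 𝓘(ℝ, 𝔼 2)⟯
      ((𝕊 2) × 𝔼 2)) {R : ℝ} (hΘ : ∀ p : (𝕊 2) × 𝔼 2, R ≤ ‖p.2‖ → Θ p = p) :
    (𝕊 4) ≃ₘ⟮𝓡 4, 𝓡 4⟯ (𝕊 4) where
  toFun := ν.pushforward Θ
  invFun := ν.pushforward Θ.symm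
  left_inv y := by
    rw [pushforward_pushforward]
    convert ν.pushforward_id y
    funext p
    simp
  right_inv y := by
    rw [pushforward_pushforward]
    convert ν.pushforward_id y
    funext p
    simp
  contMDiff_toFun := ν.contMDiff_pushforward Θ.contMDiff hΘ
  contMDiff_invFun := ν.contMDiff_pushforward Θ.symm.contMDiff fun p hp =>
    calc Θ.symm p = Θ.symm (Θ p) := by rw [hΘ p hp]
      _ = p := Θ.symm_apply_apply p

/-- The pushed-forward diffeomorphism intertwines `ν` and `ν ∘ Θ`. [folklore] -/
@[simp]
theorem pushforwardDiffeo_apply_toFun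
    (Θ : ((𝕊 2) × 𝔼 2) ≃ₘ⟮(𝓡 2).prod 𝓘(ℝ, 𝔼 2), (𝓡 2).prod 𝓘(ℝ, 𝔼 2)⟯ ((𝕊 2) × 𝔼 2))
    {R : ℝ} (hΘ : ∀ p : (𝕊 2) × 𝔼 2, R ≤ ‖p.2‖ → Θ p = p) (p : (𝕊 2) × 𝔼 2) :
    ν.pushforwardDiffeo Θ hΘ (ν.toFun p) = ν.toFun (Θ p) := by
  change ν.pushforward Θ (ν.toFun p) = _
  exact ν.pushforward_apply Θ p

/-- The pushed-forward diffeomorphism, composed with `ν`. [folklore] -/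
theorem pushforwardDiffeo_comp_toFun
    (Θ : ((𝕊 2) × 𝔼 2) ≃ₘ⟮(𝓡 2).prod 𝓘(ℝ, 𝔼 2), (𝓡 2).prod 𝓘(ℝ, 𝔼 2)⟯ ((𝕊 2) × 𝔼 2))
    {R : ℝ} (hΘ : ∀ p : (𝕊 2) × 𝔼 2, R ≤ ‖p.2‖ → Θ p = p) :
    ⇑(ν.pushforwardDiffeo Θ hΘ) ∘ ν.toFun = ν.toFun ∘ Θ :=
  funext fun p => ν.pushforwardDiffeo_apply_toFun Θ hΘ p

end TwoKnot.TubularNbhd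

end Literature.Topology.FourManifolds

end
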